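import Summits.CriticalPhenomena.CardyFormulaZ2.Theorems.CardyIKTransportCornerLineDescentFreezeGeometry

/-!
# The frozen end `p = 0` of the corner line: the sandwich of the frozen-gauge crossing event on a good grid

Support file for the registered stub `stub_FreezeHomogenisation` of the line `symmetric-seed-second-order` of the
crux `CardyIKTransport.CornerLineDescent` (stmt-CriticalPhenomena-10964).  For a bit configuration `ω` with no
syndromes, normalised flip enumerations of its column and row bits, sup-distortion `θ M` of the grid on the window
`[-M, M]²` (`2 Rad + 4δ ≤ δ M`, `θ ≤ 1/2`, `δ(2θM + 6) ≤ ρ`), and a conformal rectangle `R` drawn (with its enlarged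
domain) in the ball of radius `Rad`:
* UPPER (`couplingMap_mem_upperCrossing`): the frozen-gauge crude crossing of the rotated rectangle `e^{iπ/4} R` at
  mesh `δ` forces the `ρ`-fattened crude crossing `upperCrossing R ρ (2δ)` of the coupled standard-lattice configuration
  (project the black cell path to the black blocks and to the lattice; every visited vertex is within `δ(2θM + 4)` of
  a cell of the window; the white-endpoint degenerate case uses the black neighbouring block);
* LOWER (anchor `frozen_crossing_of_lowerCrossing`, `mem_crossingEvent_of_couplingMap_mem_lowerCrossing`): the thinned
  collar-to-collar crossing `lowerCrossing R κ ρ (2δ)` of the coupled configuration forces the frozen-gauge crude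
  crossing of `e^{iπ/4} R` at mesh `δ` (lift the lattice path to the black blocks and to a black cell path inside the
  rotated enlarged domain — the cells of a visited block are within `ρ` of its rotated vertex — then extract the run
  inside the rotated carrier, `exists_crossing_run`, edges `≤ √2 δ ≤ κ`).
References: Bollobás–Riordan, *Percolation* (2006) Ch. 7 p. 195; route file `Theses/CardyIKTransport.lean` (items
10964, 4967).
-/

noncomputable section

namespace Summit.CriticalPhenomena.CardyFormulaZ2.Theorems.CornerLineDescent.SymmetricSeed

open scoped BigOperators Topology Classical MeasureTheory ProbabilityTheory ENNReal NNReal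
open Filter Set Function MeasureTheory
open Literature.Probability.Percolation (sitePercolation bondPercolation half BondConfig embDomainCrossing rectangle
  openGraph openGraph_adj openConnIn openCrossing)
open Literature.Probability.LatticeModels
open Literature.Probability.RandomPlanarGeometry

namespace Freeze

section Sandwich

variable {ω : Bits} (h0 : ω.2.2.1 = ∅) (eA : FlipEnum ω.1) (eB : FlipEnum ω.2.1)
  (hA0 : eA.pos 0 ≤ 0 ∧ 0 < eA.pos 1) (hB0 : eB.pos 0 ≤ 0 ∧ 0 < eB.pos 1)
  {M : ℕ} {θ δ ρ Rad : ℝ} (hδ : 0 < δ)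
  (hdA : ∀ m : ℤ, |m| ≤ M → |2 * (flipCount ω.1 m : ℝ) - m| ≤ θ * M)
  (hdB : ∀ m : ℤ, |m| ≤ M → |2 * (flipCount ω.2.1 m : ℝ) - m| ≤ θ * M)

include hA0 hB0 hdA hdB in
/-- DISPLACEMENT ON THE WINDOW: a cell of `[-M, M]²` is within `δ(2θM + 2)` of the reference point of its block. [folklore] -/
theorem dist_cellPos_refT_blockIdx_le (hδ' : 0 ≤ δ) {y : Site 2} (hy0 : |y 0| ≤ M) (hy1 : |y 1| ≤ M) :
    dist ((δ : ℂ) * cellPos y) (refT δ (cls ω) (blockIdx eA eB y)) ≤ δ * (2 * θ * M + 2) := by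
  refine (dist_cellPos_refT_le δ hδ' (cls_eq ω) _ y).trans ?_
  rw [blockIdx_eq_flipCount eA eB hA0 hB0]
  have h1 := hdA (y 0) hy0
  have h2 := hdB (y 1) hy1
  rw [abs_sub_comm] at h1 h2
  nlinarith

include hδ in
/-- Cells drawn in the ball of radius `Rad ≤ δ M` lie in the window `[-M, M]²`. [folklore] -/
theorem abs_apply_le_of_norm_lt (hRM : Rad ≤ δ * M) {y : Site 2} (hy : ‖(δ : ℂ) * cellPos y‖ < Rad) :
    |y 0| ≤ M ∧ |y 1| ≤ M := by
  rw [norm_mul, Complex.norm_real, Real.norm_eq_abs, abs_of_pos hδ] at hy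
  have hn : ‖cellPos y‖ < M := by
    by_contra hc; push Not at hc
    have := mul_le_mul_of_nonneg_left hc hδ.le
    linarith
  have hre : |(y 0 : ℝ)| ≤ ‖cellPos y‖ := by
    have := Complex.abs_re_le_norm (cellPos y); simpa [cellPos] using this
  have him : |(y 1 : ℝ)| ≤ ‖cellPos y‖ := by
    have := Complex.abs_im_le_norm (cellPos y); simpa [cellPos] using this
  constructor
  · have : |((y 0 : ℤ) : ℝ)| ≤ (M : ℝ) := by linarith
    exact_mod_cast this
  · have : |((y 1 : ℤ) : ℝ)| ≤ (M : ℝ) := by linarith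
    exact_mod_cast this

include hA0 hB0 hδ hdA hdB in
/-- CELLS OF THE BLOCK OF A LATTICE VERTEX DRAWN IN THE BALL: if `‖2δ z x‖ < Rad` with `2 Rad + 4δ ≤ δ M`, `θ ≤ 1/2`,
then every cell `z` of the block `latBlk x` lies in the window and within `δ(2θM + 2)` of `e^{iπ/4} (2δ z x)`. [folklore] -/
theorem dist_cellPos_rot_le (hRM : 2 * Rad + 4 * δ ≤ δ * M) (hθ : θ ≤ 1 / 2) {x : Site 2}
    (hx : ‖(((2 * δ : ℝ)) : ℂ) * squareLatticeEmbedding.z x‖ < Rad) {z : Site 2}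
    (hz : blockIdx eA eB z = latBlk (cls ω) x) :
    dist ((δ : ℂ) * cellPos z) (rotEighth ((((2 * δ : ℝ)) : ℂ) * squareLatticeEmbedding.z x)) ≤ δ * (2 * θ * M + 2) := by
  have hnorm : ‖refT δ (cls ω) (latBlk (cls ω) x)‖ < Rad := by rw [refT_latBlk, norm_rotEighth]; exact hx
  -- the block indices are small
  have hre := (Complex.abs_re_le_norm (refT δ (cls ω) (latBlk (cls ω) x))).trans_lt hnorm
  have him := (Complex.abs_im_le_norm (refT δ (cls ω) (latBlk (cls ω) x))).trans_lt hnorm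
  simp only [refT, Complex.mul_re, Complex.ofReal_re, Complex.add_re, Complex.intCast_re, Complex.mul_im,
    Complex.intCast_im, Complex.I_re, mul_zero, Complex.I_im, mul_one, sub_self, add_zero, Complex.ofReal_im,
    zero_mul, sub_zero, Complex.add_im, zero_add] at hre him
  push_cast at hre him
  rw [abs_mul, abs_of_pos hδ] at hre him
  have hM0 : (0 : ℝ) ≤ M := Nat.cast_nonneg M
  have hc := cls_eq ω
  have hθM : θ * M ≤ M / 2 := by nlinarith [hM0, hθ]
  have hRδ : Rad ≤ δ * (M / 2 - 2) := by linarith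
  have hi : 2 * |((latBlk (cls ω) x).1 : ℝ)| < M - θ * M := by
    have h1 : δ * (2 * |((latBlk (cls ω) x).1 : ℝ)|) < Rad := by rwa [abs_mul, abs_of_pos two_pos] at hre
    have h2 : δ * (2 * |((latBlk (cls ω) x).1 : ℝ)|) < δ * (M / 2 - 2) := h1.trans_le hRδ
    have h3 := lt_of_mul_lt_mul_left h2 hδ.le
    linarith
  have hj : 2 * |((latBlk (cls ω) x).2 : ℝ)| < M - θ * M := by
    have h2 : 2 * |((latBlk (cls ω) x).2 : ℝ)| ≤ |2 * ((latBlk (cls ω) x).2 : ℝ) - 2 * (cls ω : ℝ)| + 2 := by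
      have h3 := abs_sub_abs_le_abs_sub (2 * ((latBlk (cls ω) x).2 : ℝ)) (2 * (cls ω : ℝ))
      rw [abs_mul, abs_of_pos two_pos] at h3
      have hc2 : |2 * (cls ω : ℝ)| ≤ 2 := by rcases hc with h | h <;> rw [h] <;> norm_num
      linarith
    have h4 : δ * (2 * |((latBlk (cls ω) x).2 : ℝ)|) < δ * (M / 2) := by nlinarith
    have h5 := lt_of_mul_lt_mul_left h4 hδ.le
    linarith
  have hz0 : |z 0| ≤ M :=
    abs_le_of_runIdx_eq eA hA0 hdA hi (by have := congrArg Prod.fst hz; simpa [blockIdx] using this)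
  have hz1 : |z 1| ≤ M :=
    abs_le_of_runIdx_eq eB hB0 hdB hj (by have := congrArg Prod.snd hz; simpa [blockIdx] using this)
  have := dist_cellPos_refT_blockIdx_le eA eB hA0 hB0 hdA hdB hδ.le hz0 hz1
  rwa [hz, refT_latBlk] at this

/-- The crude event of the rotated rectangle, unfolded on cells. [folklore] -/
theorem mem_crossingEvent_map_iff (R : ConformalRectangle) (δ : ℝ) (ω : Bits) :
    ω ∈ crossingEvent (R.map rotEighth) δ ↔ ∃ u, Metric.infDist ((δ : ℂ) * cellPos u) (rotEighth '' R.arc 0) ≤ 2 * δ ∧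
      ∃ v, Metric.infDist ((δ : ℂ) * cellPos v) (rotEighth '' R.arc 2) ≤ 2 * δ ∧
        gaugeEdges ω ∈ openConnIn {y | (δ : ℂ) * cellPos y ∈ rotEighth '' R.carrier} u v := by
  simp only [crossingEvent, Literature.Probability.Percolation.mem_embDomainCrossing_iff, MarkedDomain.carrier_map,
    MarkedDomain.arc_map, Set.mem_setOf_eq]
  rfl

/-- An endpoint of a gauge edge is black. [folklore] -/
theorem gaugeColour_of_adj {x y : Site 2} (h : (openGraph (gaugeEdges ω)).Adj x y) : gaugeColour ω x := by
  rw [openGraph_adj] at h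
  rcases (mem_gaugeEdges_iff ω x y).1 h.1 with ⟨hx, -, -⟩ | ⟨-, hx, -⟩ <;> exact hx

include h0 hA0 hB0 hδ hdA hdB in
/-- THE UPPER SANDWICH.  On the good-grid event (normalised flip enumerations, sup-distortion `θ M` on the window
`[-M, M]²`, `2 Rad + 4δ ≤ δ M`, `δ(2θM + 6) ≤ ρ`, carrier inside the ball of radius `Rad`), the frozen-gauge crude
crossing of the rotated rectangle `e^{iπ/4} R` at mesh `δ` forces the `ρ`-fattened crude crossing of `R` at mesh `2δ`
for the coupled standard-lattice configuration: project the black cell path to the black blocks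
(`blockConnIn_of_openConnIn`), then to the lattice (`latticeConnIn_of_blockConnIn`); every visited lattice vertex is
within `δ(2θM+2)` of a cell of the window. [folklore] -/
theorem couplingMap_mem_upperCrossing (hRM : 2 * Rad + 4 * δ ≤ δ * M) (hdisp : δ * (2 * θ * M + 6) ≤ ρ)
    (R : ConformalRectangle) (hRad : R.carrier ⊆ Metric.ball 0 Rad) (hmem : ω ∈ crossingEvent (R.map rotEighth) δ) :
    couplingMap eA eB (cls ω) ω.2.2.2.2 ∈ upperCrossing R ρ (2 * δ) := by
  rw [mem_crossingEvent_map_iff] at hmem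
  obtain ⟨u, hu, v, hv, huv⟩ := hmem
  set c := cls ω with hc
  set W : Set (Site 2) := {y | (δ : ℂ) * cellPos y ∈ rotEighth '' R.carrier} with hW
  have hRM' : Rad ≤ δ * M := by nlinarith [hδ]
  -- cells of the window: in the ball, hence displaced by at most `δ(2θM+2)` from their reference points
  have hwin : ∀ y ∈ W, dist ((δ : ℂ) * cellPos y) (refT δ c (blockIdx eA eB y)) ≤ δ * (2 * θ * M + 2) := by
    intro y hy
    obtain ⟨q, hq, hqy⟩ := hy
    have hn : ‖(δ : ℂ) * cellPos y‖ < Rad := by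
      rw [← hqy, norm_rotEighth]; simpa using hRad hq
    obtain ⟨hy0, hy1⟩ := abs_apply_le_of_norm_lt hδ hRM' hn
    exact dist_cellPos_refT_blockIdx_le eA eB hA0 hB0 hdA hdB hδ.le hy0 hy1
  have huW : u ∈ W := by obtain ⟨hx, -, -⟩ := huv; exact hx
  have hvW : v ∈ W := by obtain ⟨-, hy, -⟩ := huv; exact hy
  -- a lattice vertex of the upper window from a cell of `W` and a block of the class within `δ(2θM+4)` of it
  have hS : ∀ {y : Site 2} {b : ℤ × ℤ}, y ∈ W → Even (b.1 + b.2 - c) →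
      dist ((δ : ℂ) * cellPos y) (refT δ c b) ≤ δ * (2 * θ * M + 4) →
      Metric.infDist ((((2 * δ : ℝ)) : ℂ) * squareLatticeEmbedding.z (blkLat c b)) R.carrier ≤ ρ ∧
      ∀ (i : Fin 4), Metric.infDist ((δ : ℂ) * cellPos y) (rotEighth '' R.arc i) ≤ 2 * δ →
        Metric.infDist ((((2 * δ : ℝ)) : ℂ) * squareLatticeEmbedding.z (blkLat c b)) (R.arc i) ≤ ρ := by
    intro y b hy hb hd
    rw [← infDist_rot _ R.carrier, rot_z_blkLat hb]
    refine ⟨?_, fun i hi => ?_⟩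
    · have h1 : Metric.infDist ((δ : ℂ) * cellPos y) (rotEighth '' R.carrier) = 0 := Metric.infDist_zero_of_mem hy
      have h2 := Metric.infDist_le_infDist_add_dist (s := rotEighth '' R.carrier) (x := refT δ c b) (y := (δ : ℂ) * cellPos y)
      rw [dist_comm] at hd; linarith
    · rw [← infDist_rot _ (R.arc i), rot_z_blkLat hb]
      have h2 := Metric.infDist_le_infDist_add_dist (s := rotEighth '' R.arc i) (x := refT δ c b) (y := (δ : ℂ) * cellPos y)
      rw [dist_comm] at hd; linarith
  by_cases hbu : gaugeColour ω u
  · -- MAIN CASE: `u` black; project the cell path to blocks, then to the lattice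
    have hcu : Even ((blockIdx eA eB u).1 + (blockIdx eA eB u).2 - c) := (gaugeColour_iff_even_cls h0 eA eB hA0 hB0 u).1 hbu
    have hbv : gaugeColour ω v := by
      rw [mem_openConnIn_iff_exists_openWalk] at huv
      obtain ⟨p, -⟩ := huv
      cases hp : p.reverse with
      | nil => exact hbu
      | cons hadj _ => exact gaugeColour_of_adj hadj
    have hcv : Even ((blockIdx eA eB v).1 + (blockIdx eA eB v).2 - c) := (gaugeColour_iff_even_cls h0 eA eB hA0 hB0 v).1 hbv
    have hblk := blockConnIn_of_openConnIn h0 eA eB huv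
    have hlat := latticeConnIn_of_blockConnIn eA eB (c := c) hcu hblk
    refine ⟨blkLat c (blockIdx eA eB u), ?_, blkLat c (blockIdx eA eB v), ?_, openConnIn_mono ?_ _ _ hlat⟩
    · exact (hS huW hcu ((hwin u huW).trans (by nlinarith [hδ]))).2 0 hu
    · exact (hS hvW hcv ((hwin v hvW).trans (by nlinarith [hδ]))).2 2 hv
    · rintro _ ⟨b, ⟨⟨y, hy, rfl⟩, hb⟩, rfl⟩
      exact (hS hy hb ((hwin y hy).trans (by nlinarith [hδ]))).1
  · -- DEGENERATE CASE: `u` white, so the path is trivial and `u = v`; use the black neighbouring block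
    have huv' : u = v := by
      rw [mem_openConnIn_iff_exists_openWalk] at huv
      obtain ⟨p, -⟩ := huv
      cases p with
      | nil => rfl
      | cons hadj _ => exact absurd (gaugeColour_of_adj hadj) hbu
    subst huv'
    set b : ℤ × ℤ := ((blockIdx eA eB u).1 + 1, (blockIdx eA eB u).2) with hb
    have hbc : Even (b.1 + b.2 - c) := by
      have h1 := (gaugeColour_iff_even_cls h0 eA eB hA0 hB0 u).not.1 hbu
      rw [Int.not_even_iff_odd] at h1
      obtain ⟨k, hk⟩ := h1
      exact ⟨k + 1, by simp [hb]; omega⟩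
    have hd : dist ((δ : ℂ) * cellPos u) (refT δ c b) ≤ δ * (2 * θ * M + 4) := by
      have h1 := hwin u huW
      have h2 : dist (refT δ c (blockIdx eA eB u)) (refT δ c b) = 2 * δ := by
        rw [Complex.dist_eq, refT, refT, ← mul_sub, norm_mul, Complex.norm_real, Real.norm_eq_abs, abs_of_pos hδ]
        simp [hb]; ring_nf; simp
      have := dist_triangle ((δ : ℂ) * cellPos u) (refT δ c (blockIdx eA eB u)) (refT δ c b)
      nlinarith
    obtain ⟨h1, h2⟩ := hS huW hbc hd
    refine ⟨blkLat c b, h2 0 hu, blkLat c b, h2 2 hv, ?_⟩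
    exact ⟨h1, h1, SimpleGraph.Reachable.refl _⟩

include h0 hA0 hB0 hδ hdA hdB in
/-- THE LOWER SANDWICH.  On the good-grid event (as above, with `θ ≤ 1/2`, `√2 δ ≤ κ`, `0 ≤ ρ` and the enlarged
domain inside the ball of radius `Rad`), the thinned collar-to-collar crossing of `R` at mesh `2δ` for the coupled
standard-lattice configuration forces the frozen-gauge crude crossing of `e^{iπ/4} R` at mesh `δ`: lift the lattice path
to the black blocks (`blockConnIn_of_latticeConnIn`) and to a black cell path inside the rotated enlarged domain
(`openConnIn_of_blockConnIn`; the cells of a visited block are within `ρ` of its rotated lattice vertex), then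
extract the run inside the rotated carrier (`exists_crossing_run`). [folklore] -/
theorem mem_crossingEvent_of_couplingMap_mem_lowerCrossing (hRM : 2 * Rad + 4 * δ ≤ δ * M) (hθ : θ ≤ 1 / 2)
    (hdisp : δ * (2 * θ * M + 6) ≤ ρ) (hρ : 0 ≤ ρ) {κ : ℝ} (hκ : Real.sqrt 2 * δ ≤ κ)
    (R : ConformalRectangle) (hRad : enlarge R κ ⊆ Metric.ball 0 Rad)
    (hmem : couplingMap eA eB (cls ω) ω.2.2.2.2 ∈ lowerCrossing R κ ρ (2 * δ)) :
    ω ∈ crossingEvent (R.map rotEighth) δ := by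
  set c := cls ω with hc
  obtain ⟨xu, hxu, xv, hxv, hconn⟩ := hmem
  set SL : Set (Site 2) := {x | Metric.closedBall ((((2 * δ : ℝ)) : ℂ) * squareLatticeEmbedding.z x) ρ ⊆ enlarge R κ}
  -- every cell of the block of a vertex of `SL` (or of the endpoint sets) is within `ρ` of the rotated vertex
  have hcell : ∀ {x : Site 2} {T : Set ℂ}, T ⊆ Metric.ball 0 Rad →
      Metric.closedBall ((((2 * δ : ℝ)) : ℂ) * squareLatticeEmbedding.z x) ρ ⊆ T →
      ∀ z : Site 2, blockIdx eA eB z = latBlk c x → (δ : ℂ) * cellPos z ∈ rotEighth '' T := by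
    intro x T hT hxT z hz
    have hx : ‖(((2 * δ : ℝ)) : ℂ) * squareLatticeEmbedding.z x‖ < Rad := by
      simpa using hT (hxT (Metric.mem_closedBall_self hρ))
    have hd := dist_cellPos_rot_le eA eB hA0 hB0 hδ hdA hdB hRM hθ hx hz
    have hmem : (δ : ℂ) * cellPos z ∈ Metric.closedBall (rotEighth ((((2 * δ : ℝ)) : ℂ) * squareLatticeEmbedding.z x)) ρ := by
      rw [Metric.mem_closedBall]; nlinarith [hδ]
    rw [← rot_image_closedBall] at hmem
    exact Set.image_mono hxT hmem
  -- black cells at the endpoints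
  set u : Site 2 := cornerCell eA eB (latBlk c xu).1 (latBlk c xu).2 with hu
  set v : Site 2 := cornerCell eA eB (latBlk c xv).1 (latBlk c xv).2 with hv
  have hbu : blockIdx eA eB u = latBlk c xu := blockIdx_cornerCell eA eB _ _
  have hbv : blockIdx eA eB v = latBlk c xv := blockIdx_cornerCell eA eB _ _
  have hublack : gaugeColour ω u := by
    rw [gaugeColour_iff_even_cls h0 eA eB hA0 hB0, hbu]; exact even_latBlk c xu
  -- lattice path → block path → cell path inside the rotated enlarged domain
  have hblk := blockConnIn_of_latticeConnIn eA eB c hconn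
  set Wp : Set (Site 2) := {y | (δ : ℂ) * cellPos y ∈ rotEighth '' enlarge R κ} with hWp
  have hSW : ∀ z : Site 2, blockIdx eA eB z ∈ latBlk c '' SL → z ∈ Wp := by
    rintro z ⟨x, hx, hzx⟩
    exact hcell hRad hx z hzx.symm
  rw [← hbu, ← hbv] at hblk
  have hcellpath := openConnIn_of_blockConnIn h0 eA eB hSW hublack hblk
  rw [mem_openConnIn_iff_exists_openWalk] at hcellpath
  obtain ⟨p, hp⟩ := hcellpath
  -- run extraction in the rotated rectangle
  have hstep : ∀ x y : Site 2, (openGraph (gaugeEdges ω)).Adj x y →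
      dist ((δ : ℂ) * cellPos x) ((δ : ℂ) * cellPos y) ≤ Real.sqrt 2 * δ := by
    intro x y hxy
    rw [openGraph_adj] at hxy
    rw [Complex.dist_eq, ← mul_sub, norm_mul, Complex.norm_real, Real.norm_eq_abs, abs_of_pos hδ, ← Complex.dist_eq,
      mul_comm]
    exact mul_le_mul_of_nonneg_right (dist_cellPos_le_of_mem_gaugeEdges hxy.1) hδ.le
  have hcol : ∀ (i : Fin 4) {x : Site 2} {w : Site 2}, sideCollar R i κ \ R.carrier ⊆ Metric.ball 0 Rad →
      Metric.closedBall ((((2 * δ : ℝ)) : ℂ) * squareLatticeEmbedding.z x) ρ ⊆ sideCollar R i κ \ R.carrier →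
      blockIdx eA eB w = latBlk c x → (δ : ℂ) * cellPos w ∈ sideCollar (R.map rotEighth) i κ \ (R.map rotEighth).carrier := by
    intro i x w hsub hx hw
    have := hcell hsub hx w hw
    rwa [Set.image_sdiff rotEighth.injective, ← sideCollar_map, ← MarkedDomain.carrier_map] at this
  obtain ⟨a, b, q, hq, ha, hb⟩ := exists_crossing_run (fun y => (δ : ℂ) * cellPos y) hκ hstep (R.map rotEighth) p
    (hcol 0 (fun q hq => hRad (Or.inl (Or.inr hq.1))) hxu hbu) (hcol 2 (fun q hq => hRad (Or.inr hq.1)) hxv hbv)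
    (fun y hy => by rw [enlarge_map]; exact hp y hy)
  have h2 : Real.sqrt 2 * δ ≤ 2 * δ := by
    have : Real.sqrt 2 ≤ 2 := by
      rw [show (2:ℝ) = Real.sqrt 4 by rw [show (4:ℝ) = 2 ^ 2 by norm_num, Real.sqrt_sq zero_le_two]]
      exact Real.sqrt_le_sqrt (by norm_num)
    nlinarith
  rw [mem_crossingEvent_map_iff]
  refine ⟨a, ?_, b, ?_, ?_⟩
  · rw [← MarkedDomain.arc_map]; exact ha.trans h2
  · rw [← MarkedDomain.arc_map]; exact hb.trans h2
  · rw [mem_openConnIn_iff_exists_openWalk]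
    refine ⟨q, fun y hy => ?_⟩
    have := hq y hy
    rwa [MarkedDomain.carrier_map] at this

end Sandwich

end Freeze

/-- ANCHOR (registered sub-goal). THE LOWER SANDWICH OF THE FROZEN END: on a good grid, the thinned collar-to-collar crude
crossing of `R` at mesh `2δ` for the coupled standard-lattice configuration forces the frozen-gauge crude crossing of
the rotated rectangle `e^{iπ/4} R` at mesh `δ`. [folklore] -/
theorem frozen_crossing_of_lowerCrossing : ∀ (ω : Bits), ω.2.2.1 = ∅ → ∀ (eA : Freeze.FlipEnum ω.1) (eB : Freeze.FlipEnum ω.2.1), (eA.pos 0 ≤ 0 ∧ 0 < eA.pos 1) → (eB.pos 0 ≤ 0 ∧ 0 < eB.pos 1) → ∀ (M : ℕ) (θ δ ρ Rad κ : ℝ), 0 < δ → (∀ m : ℤ, |m| ≤ M → |2 * (Freeze.flipCount ω.1 m : ℝ) - m| ≤ θ * M) → (∀ m : ℤ, |m| ≤ M → |2 * (Freeze.flipCount ω.2.1 m : ℝ) - m| ≤ θ * M) → 2 * Rad + 4 * δ ≤ δ * M → θ ≤ 1 / 2 → δ * (2 * θ * M + 6) ≤ ρ → 0 ≤ ρ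 → Real.sqrt 2 * δ ≤ κ → ∀ (R : ConformalRectangle), Freeze.enlarge R κ ⊆ Metric.ball 0 Rad → Freeze.couplingMap eA eB (Freeze.cls ω) ω.2.2.2.2 ∈ Freeze.lowerCrossing R κ ρ (2 * δ) → ω ∈ crossingEvent (R.map Freeze.rotEighth) δ :=
  fun _ h0 eA eB hA0 hB0 _ _ _ _ _ _ hδ hdA hdB hRM hθ hdisp hρ hκ R hRad hmem =>
    Freeze.mem_crossingEvent_of_couplingMap_mem_lowerCrossing h0 eA eB hA0 hB0 hδ hdA hdB hRM hθ hdisp hρ hκ R hRad hmem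

end Summit.CriticalPhenomena.CardyFormulaZ2.Theorems.CornerLineDescent.SymmetricSeed
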